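import Summits.CriticalPhenomena.PercolationContinuityZ3.Theorems.Transplant.SkelPhiCorridorKGYRoute
import HarnessLib

/-!
# N2 (frames-only node `SamePDropOfSkeletonFrm₁`, OPEN), (C) column, J17 REPAIR, file 1: THE SECOND-AXIS K-G CORRIDOR SCHEDULE WITH THE UNION PRISM —
# `Skelφ.kgCorrSchedYU` (regions, levels, cores, radii and strides of `kgCorrSchedY` VERBATIM; `prism := ⋃_{k ≤ N′} region k`) and its per-step routed input
# `hrouteS_kgCorrYU`

WHY (J17, stmt-g20 2026-08-23T05:45:58Z; lead numbering 05:48:28Z): the y′-run drifts by `v` per hop, so the axis-parallel frame box holding the whole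
slanted run prism (`RunPrm.InPrism`, `mem_kgCorrSchedY_prism_box`) is `(N+2)|v|` wide and its fine x-reading `≈ 40K·s₀·(v/n)` exceeds the cell's
transverse room `2K·s₀` unless `|vL| ≤ nL/20` (not a Step-I fact); each REGION, however, reads within `O(s₀)` of the column (the fine x-coordinate
`s₀·(m·x′ − v·β′)/(n·m)` is invariant along the run direction). The generic clauses (`hkits_schedFHabC/FC`, `hkits_levelFHabC`) touch `Sc.prism` only
through `level ⊆ region ⊆ prism`, and `ScheduleNP.prism` is a free field under the one law `sub_prism`; so the schedule with the SMALLEST admissible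
prism — the union of its regions — makes `hΩball` a per-region statement, with every other field and every view lemma of `kgCorrSchedY` unchanged.
* §1 `kgCorrSchedYU`, `kgCorrSchedYU_region/_lo/_hi/_N/_R'` (rfl), `mem_kgCorrSchedYU_prism` (`↔ ∃ k ≤ N′, · ∈ region k`);
* §2 **`hrouteS_kgCorrYU`** (the proof of `hrouteS_kgCorrY` verbatim).
builds on p205010 (kernel theorem, internal audit signed; external expert review pending) — nothing in this file uses p205010; nothing here is a claim
about the open node `SamePDropOfSkeletonFrm₁`.
Lane `prim-bschramm`, seat `prim-bschramm-p5` (gen 16; (C) lineage); helper file (`--supports stmt-CriticalPhenomena-4575 --as helper`).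
[cite: KozmaNitzan2024, §4 Lemma 11 (p. 22: the slabs of Ω), Lemma 12 (pp. 23–25)] [cite: MartineauTassion2017, §4.3 Lemma 4.2]
-/

noncomputable section

open scoped Classical

namespace Summit.CriticalPhenomena.PercolationContinuityZ3.Theorems.Transplant

namespace Skelφ

open MeasureTheory
open Literature.Probability.Percolation Literature.Probability.LatticeModels SimpleGraph KNLevels
open Literature.Barriers.CriticalPhenomena (graphBall graphBall_mono)
open Skel (winGraph winGraph_le winGraphIn winGraphIn_le)
open Literature.Probability.Percolation.KozmaNitzan.Cells (oth)
open ChainPlanar ChainPara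

variable {V : Type} [DecidableEq V] [Countable V] {G : SimpleGraph V} [G.LocallyFinite] {φ : V → Site 2}

section KG

variable {n ℓ : ℕ} {h v : ℤ} {R' ρ q W N m₁ Wm₂ Wp₂ m₂ : ℕ} (hn : 1 ≤ n) (hv : |v| ≤ n) (hlay : (n + h.natAbs : ℕ) ≤ (n : ℤ) * ℓ + 1)
  (hP₁ : ParkOK (kgPark₁Y n ℓ h v R' ρ q W N m₁)) (hP₂ : ParkOK (kgPark₂Y n ℓ h v R' ρ q W N m₁ Wm₂ Wp₂ m₂))
  (hsplit : (Wm₂ : ℤ) + Wp₂ = (kgPark₁Y n ℓ h v R' ρ q W N m₁).aHi (m₁ + 1) - ParkPrm.aLo (kgPark₁Y n ℓ h v R' ρ q W N m₁) (m₁ + 1))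

/-! ## §1 The schedule with the union prism -/

/-- **THE SECOND-AXIS K-G CORRIDOR SCHEDULE WITH THE UNION PRISM**: `kgCorrSchedY` with `prism := ⋃_{k ≤ N′} region k`. [this work] -/
def kgCorrSchedYU : ScheduleNP :=
  { kgCorrSchedY hn hv hlay hP₁ hP₂ hsplit with
    prism := (Finset.range ((kgCorrSchedY hn hv hlay hP₁ hP₂ hsplit).N + 1)).biUnion (kgCorrSchedY hn hv hlay hP₁ hP₂ hsplit).region
    sub_prism := fun _ hk =>
      Finset.subset_biUnion_of_mem (kgCorrSchedY hn hv hlay hP₁ hP₂ hsplit).region (Finset.mem_range.2 (Nat.lt_succ_of_le hk)) }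

/-- Unchanged field. [folklore] -/
@[simp] theorem kgCorrSchedYU_region : (kgCorrSchedYU hn hv hlay hP₁ hP₂ hsplit).region = (kgCorrSchedY hn hv hlay hP₁ hP₂ hsplit).region := rfl

/-- Unchanged field. [folklore] -/
@[simp] theorem kgCorrSchedYU_lo : (kgCorrSchedYU hn hv hlay hP₁ hP₂ hsplit).lo = (kgCorrSchedY hn hv hlay hP₁ hP₂ hsplit).lo := rfl

/-- Unchanged field. [folklore] -/
@[simp] theorem kgCorrSchedYU_hi : (kgCorrSchedYU hn hv hlay hP₁ hP₂ hsplit).hi = (kgCorrSchedY hn hv hlay hP₁ hP₂ hsplit).hi := rfl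

/-- Unchanged field. [folklore] -/
@[simp] theorem kgCorrSchedYU_N : (kgCorrSchedYU hn hv hlay hP₁ hP₂ hsplit).N = (kgCorrSchedY hn hv hlay hP₁ hP₂ hsplit).N := rfl

/-- Unchanged field. [folklore] -/
@[simp] theorem kgCorrSchedYU_R' : (kgCorrSchedYU hn hv hlay hP₁ hP₂ hsplit).R' = (kgCorrSchedY hn hv hlay hP₁ hP₂ hsplit).R' := rfl

/-- Unchanged cores. [folklore] -/
theorem kgCorrSchedYU_core (k : ℕ) : ScheduleNP.core (kgCorrSchedYU hn hv hlay hP₁ hP₂ hsplit) k = ScheduleNP.core (kgCorrSchedY hn hv hlay hP₁ hP₂ hsplit) k := rfl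

/-- **The union prism**: `y ∈ prism ↔ ∃ k ≤ N′, y ∈ region k`. [folklore] -/
theorem mem_kgCorrSchedYU_prism {y : Site 2} :
    y ∈ (kgCorrSchedYU hn hv hlay hP₁ hP₂ hsplit).prism ↔ ∃ k, k ≤ (kgCorrSchedY hn hv hlay hP₁ hP₂ hsplit).N ∧ y ∈ (kgCorrSchedY hn hv hlay hP₁ hP₂ hsplit).region k := by
  show y ∈ (Finset.range _).biUnion _ ↔ _
  simp only [Finset.mem_biUnion, Finset.mem_range, Nat.lt_succ_iff]

/-! ## §2 The per-step routed input over the union prism -/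

/-- **THE PER-STEP PER-CENTRE PARKED-OR-ROUTED INPUT OF THE SECOND-AXIS CORRIDOR WITH THE UNION PRISM** (`hrouteS_kgCorrY`'s proof
verbatim; the window-in-habitat row `hΩball` now quantifies over the union of the regions only). [cite: KozmaNitzan2024, §4 Lemma 10 Step IV, Lemma 12] -/
theorem hrouteS_kgCorrYU (c₀ : V) {σ : ℤ} (hσ : σ = 1 ∨ σ = -1) {w₀ : V} {R r Rl : ℕ} (hr : Rl ≤ r) (hrR : r ≤ R)
    {Ω : Finset V} (hΩball : ∀ u ∈ graphBall G w₀ R, runX φ c₀ n h σ u ∈ (kgCorrSchedYU hn hv hlay hP₁ hP₂ hsplit).prism → u ∈ Ω) (Rim : ℕ → Finset V)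
    {q' : unitInterval} {W' : Sym2 V → unitInterval}
    (hWD : ∀ k ≤ (kgCorrSchedYU hn hv hlay hP₁ hP₂ hsplit).N, IsSubbox (winGraphIn G Ω) W' q' (WinIn (runX φ c₀ n h σ) Ω ((kgCorrSchedYU hn hv hlay hP₁ hP₂ hsplit).region k)))
    (Λc : V → ℕ → Finset V) (kz : ℕ) {δ : ℝ}
    (hlong : ∀ c (τ : ℤ), τ = 1 ∨ τ = -1 → 1 - δ ^ 3 < (bondPercolation G q').real
      (linkIn (pgramPrism G φ c n h (3 * ℓ) Rl) (Λc c kz) (pgSideHalfW G φ c n h ℓ Rl σ (σ * τ))))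
    (hlongY : ∀ c (τ : ℤ), τ = 1 ∨ τ = -1 → 1 - δ ^ 3 < (bondPercolation G q').real
      (linkIn (pgramPrism G φ c n h (3 * ℓ) Rl) (Λc c kz) (pgTopPieceW G φ c n h ℓ Rl σ τ v))) :
    ∀ k ≤ (kgCorrSchedYU hn hv hlay hP₁ hP₂ hsplit).N, ∀ c : V,
      runX φ c₀ n h σ c ∈ Finset.Icc ((kgCorrSchedYU hn hv hlay hP₁ hP₂ hsplit).lo k - (((kgCorrSchedYU hn hv hlay hP₁ hP₂ hsplit).R' : ℕ) : Site 2))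
        ((kgCorrSchedYU hn hv hlay hP₁ hP₂ hsplit).hi k + (((kgCorrSchedYU hn hv hlay hP₁ hP₂ hsplit).R' : ℕ) : Site 2)) → c ∈ graphBall G w₀ (R - r) →
      c ∈ WinIn (runX φ c₀ n h σ) Ω (ScheduleNP.core (kgCorrSchedYU hn hv hlay hP₁ hP₂ hsplit) (k + 1)) ∪ Rim k ∨
      ∃ Qt Ft : Finset V, Ft ⊆ WinIn (runX φ c₀ n h σ) Ω (ScheduleNP.core (kgCorrSchedYU hn hv hlay hP₁ hP₂ hsplit) (k + 1)) ∪ Rim k ∧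
        Qt ⊆ WinIn (runX φ c₀ n h σ) Ω ((kgCorrSchedYU hn hv hlay hP₁ hP₂ hsplit).region k) ∧
        1 - δ ^ 3 ≤ (prodBernoulli W').real (linkIn (↑Qt : Set V) (Λc c kz) Ft) := by
  set S := kgCorrSchedYU hn hv hlay hP₁ hP₂ hsplit with hS
  set ψ := runX φ c₀ n h σ with hψ
  have hSN : S.N = N + 1 + m₁ + 1 + m₂ := rfl
  have hSR : S.R' = R' := rfl
  intro k hk c hc hcw
  -- generic transport: a plain window over a phase region / next core lies in the habitat window of the corridor's
  have hPDof : ∀ {Reg : Finset (Site 2)}, Reg = S.region k → Win G ψ w₀ Reg R ⊆ WinIn ψ Ω (S.region k) := by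
    intro Reg hReg u hu
    obtain ⟨huB, huP⟩ := (mem_Win G _).1 hu
    rw [hReg] at huP
    exact (mem_WinIn (φ := ψ)).2 ⟨hΩball u huB (S.sub_prism k hk huP), huP⟩
  have hPTof : ∀ {Cor : Finset (Site 2)}, Cor = ScheduleNP.core S (k + 1) → Win G ψ w₀ Cor R ⊆ WinIn ψ Ω (ScheduleNP.core S (k + 1)) ∪ Rim k := by
    intro Cor hCor u hu
    obtain ⟨huB, huP⟩ := (mem_Win G _).1 hu
    rw [hCor] at huP
    exact Finset.mem_union_left _ ((mem_WinIn (φ := ψ)).2 ⟨hΩball u huB (S.sub_prism k hk (S.succ k hk huP)), huP⟩)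
  have hDrΩ : WinIn ψ Ω (S.region k) ⊆ Ω := fun u hu => ((mem_WinIn (φ := ψ)).1 hu).1
  have hc' : ψ c ∈ ScheduleNP.level (kgCorrSchedY hn hv hlay hP₁ hP₂ hsplit) k R' := hc
  rcases kgCorrSched_step_cases (N := N) (m₁ := m₁) (m₂ := m₂) (k := k) (hk.trans_eq hSN) with hkN | ⟨j, hj, rfl⟩ | ⟨j, hj, rfl⟩
  · -- y′-run phase
    obtain ⟨hreg, hlev, -⟩ := kgCorrSchedY_run_view hn hv hlay hP₁ hP₂ hsplit hkN
    have hcs := kgCorrSchedY_core_succ_run hn hv hlay hP₁ hP₂ hsplit hkN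
    rw [hlev] at hc'
    exact hroute_yRunBIn (φ := φ) hn hv hlay R' q W N c₀ hσ (k := k) hr hrR (hPDof hreg.symm) (hPTof hcs.symm) hDrΩ (hWD k hk) Λc kz hlongY c hc' hcw
  · -- across-parking phase
    obtain ⟨hreg, hlev, -⟩ := kgCorrSchedY_park₁_view hn hv hlay hP₁ hP₂ hsplit hj
    have hcs := kgCorrSchedY_core_succ_park₁ hn hv hlay hP₁ hP₂ hsplit hj
    rw [hlev] at hc'
    exact hroute_xParkCIn (φ := φ) hP₁ (kgC₁Y n ℓ h v N) hn c₀ hσ (k := j) hr hrR (hPDof hreg.symm) (hPTof hcs.symm) hDrΩ (hWD _ hk) Λc kz hlong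
      c hc' hcw
  · -- along-parking phase
    obtain ⟨hreg, hlev, -⟩ := kgCorrSchedY_park₂_view hn hv hlay hP₁ hP₂ hsplit j
    have hcs := kgCorrSchedY_core_succ_park₂ hn hv hlay hP₁ hP₂ hsplit j
    rw [hlev] at hc'
    exact hroute_yParkCIn (φ := φ) hP₂ (kgC₂Y n ℓ h v R' ρ q W N m₁ Wp₂) hn c₀ hσ (k := j) hr hrR (hPDof hreg.symm) (hPTof hcs.symm) hDrΩ
      (hWD _ hk) Λc kz hlongY c hc' hcw


end KG

end Skelφ

end Summit.CriticalPhenomena.PercolationContinuityZ3.Theorems.Transplant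

end
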